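import Mathlib

/-!
# §CRITIC (stub-critic g41, 2026-08-29) — K3 «CONSUMER HOOK» of card k3-g40 RESOLVED IN KERNEL

Card k3-g40 (`ReadTwoCutK3G40.read₂_of_refl_cut`) delivers k3-g38's `RamifiedReading` with the REFL unit table
`ℓ γ = κ·(T γ − T (γ·γ₀))`, `κ = (2Θε)⁻¹`, where `γ₀ ∈ Γ ≃ (ℤ/2^{n+1})ˣ` is the index shift `j ↦ j + 2^n`
(`ζ^{j+2^n} = −ζ^j`), i.e. `γ₀ ↔ 1 + 2^n` (order two for `n ≥ 1`) — NOT `−1` as the card's K3 prose says.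
The consumer `atom_shape` (k3-g38, row 111 RCF) is applied ONLY to characters `χ` that do not factor through
`ℤ/2^n`, i.e. `χ(1 + 2^n) ≠ 1`, hence `χ(1 + 2^n) = −1` (the kernel of `(ℤ/2^{n+1})ˣ → (ℤ/2^n)ˣ` is `{1, 1+2^n}`;
STUB-PLAN v7.3 §4 (ρ4)).  For every such `χ` the REFL table's character sum is EXACTLY the FROB-normalised one:
`Σ_γ χ(eγ)·κ(Tγ − T(γγ₀)) = 2κ · Σ_γ χ(eγ)·Tγ = Ω⁻¹ · Σ_γ χ(eγ)·Tγ` (`2κ = (Θε)⁻¹ = Ω⁻¹`) — v7.3 (ρ5) in kernel.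
So both proved glues of k3-g40 feed `atom_shape` with the same value; no normalisation bug; K3 is not a crux.
BSD is not proved; nothing here touches the stub or the crux. -/

namespace Summit.BirchSwinnertonDyer.BirchSwinnertonDyer.Cruxes.SplitBadTwoLowerHalfOfFacts.CriticG41

/-- ★ **REFL TABLE CHARACTER SUM.**  `Γ` a finite group, `e : Γ ≃* (ℤ/N)ˣ`, `ψ` a multiplicative character with
`ψ(e γ₀) = −1` for an element `γ₀` of order dividing two: the `ψ`-sum of the reflected table `κ(Tγ − T(γγ₀))` is
`2κ` times the `ψ`-sum of `T`. (Apply with `ψ = χ⁻¹`, `γ₀ ↔ 1 + 2^n`, `κ = (2Θε)⁻¹`.) -/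
theorem refl_table_charSum {R' : Type*} [CommRing R'] {N : ℕ} [NeZero N] {Γ : Type*} [Group Γ] [Fintype Γ]
    (e : Γ ≃* (ZMod N)ˣ) (ψ : MulChar (ZMod N) R') (T : Γ → R') (κ : R') (γ₀ : Γ)
    (hγ₀ : γ₀ * γ₀ = 1) (hψ : ψ ((e γ₀ : (ZMod N)ˣ) : ZMod N) = -1) :
    ∑ γ : Γ, ψ ((e γ : (ZMod N)ˣ) : ZMod N) * (κ * (T γ - T (γ * γ₀))) =
      2 * κ * ∑ γ : Γ, ψ ((e γ : (ZMod N)ˣ) : ZMod N) * T γ := by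
  -- reindex the shifted sum by `γ ↦ γ·γ₀` (an involution since `γ₀² = 1`)
  have hre : ∑ γ : Γ, ψ ((e γ : (ZMod N)ˣ) : ZMod N) * T (γ * γ₀) =
      ∑ δ : Γ, ψ ((e (δ * γ₀) : (ZMod N)ˣ) : ZMod N) * T δ := by
    refine (Fintype.sum_equiv (Equiv.mulRight γ₀)
      (fun δ => ψ ((e (δ * γ₀) : (ZMod N)ˣ) : ZMod N) * T δ)
      (fun γ => ψ ((e γ : (ZMod N)ˣ) : ZMod N) * T (γ * γ₀)) (fun δ => ?_)).symm
    simp only [Equiv.coe_mulRight, mul_assoc, hγ₀, mul_one]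
  have hneg : ∀ δ : Γ, ψ ((e (δ * γ₀) : (ZMod N)ˣ) : ZMod N) = -ψ ((e δ : (ZMod N)ˣ) : ZMod N) := by
    intro δ
    rw [map_mul, Units.val_mul, map_mul, hψ, mul_neg, mul_one]
  have hsplit : ∀ γ : Γ, ψ ((e γ : (ZMod N)ˣ) : ZMod N) * (κ * (T γ - T (γ * γ₀))) =
      κ * (ψ ((e γ : (ZMod N)ˣ) : ZMod N) * T γ) - κ * (ψ ((e γ : (ZMod N)ˣ) : ZMod N) * T (γ * γ₀)) := by
    intro γ; ring
  simp_rw [hsplit]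
  rw [Finset.sum_sub_distrib, ← Finset.mul_sum, ← Finset.mul_sum, hre]
  simp_rw [hneg, neg_mul, Finset.sum_neg_distrib]
  ring

/-- With k3-g38's `atom_shape` output `χ⁻¹(−1)·Σ_γ χ⁻¹(eγ)·ℓ γ` and `ℓ = κ(T − T(·γ₀))`: the Gauss-side sum equals
the FROB-normalised `χ⁻¹(−1)·(2κ)·Σ_γ χ⁻¹(eγ)·T γ`. -/
theorem atom_output_refl_eq_frob {R' : Type*} [CommRing R'] {N : ℕ} [NeZero N] {Γ : Type*} [Group Γ] [Fintype Γ]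
    (e : Γ ≃* (ZMod N)ˣ) (χinv : MulChar (ZMod N) R') (T : Γ → R') (κ c₁ : R') (γ₀ : Γ)
    (hγ₀ : γ₀ * γ₀ = 1) (hχ : χinv ((e γ₀ : (ZMod N)ˣ) : ZMod N) = -1) :
    c₁ * ∑ γ : Γ, χinv ((e γ : (ZMod N)ˣ) : ZMod N) * (κ * (T γ - T (γ * γ₀))) =
      c₁ * (2 * κ) * ∑ γ : Γ, χinv ((e γ : (ZMod N)ˣ) : ZMod N) * T γ := by
  rw [refl_table_charSum e χinv T κ γ₀ hγ₀ hχ]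
  ring

/-! ### The shift element at levels `n = 1, 2` (`N = 4, 8`, `M = 2, 4`): `γ₀ = 1 + 2^n` has square `1` and is the
only non-trivial unit `≡ 1 (mod 2^n)` — so a character not factoring through `ℤ/2^n` takes the value `−1` on it
(`χ(γ₀)² = 1`, `χ(γ₀) ≠ 1`, domain). -/

example : ((1 + 2 : ZMod 4)) ^ 2 = 1 := by decide
example : ((1 + 4 : ZMod 8)) ^ 2 = 1 := by decide
example : ∀ u : ZMod 8, IsUnit u → ZMod.castHom (show 4 ∣ 8 by norm_num) (ZMod 4) u = 1 → u = 1 ∨ u = 5 := by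
  decide
example : ∀ u : ZMod 4, IsUnit u → ZMod.castHom (show 2 ∣ 4 by norm_num) (ZMod 2) u = 1 → u = 1 ∨ u = 3 := by
  decide

/-- In a domain, a value with square one that is not one is minus one (the step `χ(γ₀)² = χ(γ₀²) = 1 ⟹ χ(γ₀) = −1`). -/
theorem eq_neg_one_of_sq_eq_one {R' : Type*} [CommRing R'] [IsDomain R'] {x : R'} (hx : x ^ 2 = 1) (h1 : x ≠ 1) :
    x = -1 := by
  have h : (x - 1) * (x + 1) = 0 := by ring_nf; rw [hx]; ring
  rcases mul_eq_zero.mp h with h | h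
  · exact absurd (sub_eq_zero.mp h) h1
  · exact eq_neg_of_add_eq_zero_left h

/-- ★ `χ(γ₀) = −1` for every character non-trivial on an element of order dividing two (domain coefficients) —
the hypothesis `hχu : χ u ≠ 1` of k3-g38's `atom_shape` with `u = 1 + 2^n`. -/
theorem mulChar_eq_neg_one_of_sq {R' : Type*} [CommRing R'] [IsDomain R'] {N : ℕ} [NeZero N]
    (χ : MulChar (ZMod N) R') (u : (ZMod N)ˣ) (hu : u * u = 1) (hχu : χ (u : ZMod N) ≠ 1) :
    χ (u : ZMod N) = -1 := by
  refine eq_neg_one_of_sq_eq_one ?_ hχu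
  rw [sq, ← map_mul, ← Units.val_mul, hu, Units.val_one, map_one]

end Summit.BirchSwinnertonDyer.BirchSwinnertonDyer.Cruxes.SplitBadTwoLowerHalfOfFacts.CriticG41
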